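import Summits.AnomalousDissipation.AnomalousDissipation.Theses.TaylorCertificates
import Literature.Analysis.FluidPDE.StokesTorus

/-!
# Sketch — crux-ideate round 1, ideator 3, crux `TaylorCertificates.KolmogorovFloorEnsembleCeiling`
(stmt-AnomalousDissipation-14183, the SAME-FORCE COUPLING `KolmogorovFloor-inner(f) ∧ EnsembleCeiling-inner(f)`).

Typed companions of the idea card `idea-skew-ray-empties-intersection.md` (this seat):

* §A  the crux PER FORCE (`PairFor f`; `pair_iff` by `Iff.rfl`), its floor projection onto the band-limited class
      `FloorClassAtFor (3/4) f` (re-typed verbatim from Cruxes/KolmogorovFloor/SketchIdeator3.lean), the kill shape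
      `FloorKillAtFor`, and the logic `not_pairFor_of_kill` (PROVED): a Kolmogorov-class floor kill for `f` refutes the
      coupling for `f` whatever the ceiling half does.
* §B  the dressed-ray interface of the KolmogorovFloor chain, re-typed verbatim so that this file is self-contained:
      `IsEulerShear`, `slopeSum`, `SlopeLE`, `ApproxLinearResponse`, `DressedRayKill` (THEOREM A), `LinearResponseLemma`.
* §C  THE INTERSECTION CANDIDATES: the detuned cyclic force `f₁₂₃ = (sin 2πx₃, sin 4πx₁, sin 6πx₂)` (the EnsembleCeiling
      chain's screened witness, Cruxes/EnsembleCeiling/Ideas/sweep-test-cyclic-tlf-witness.md) and the cyclic first-shell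
      force `f_GP = (sin 2πx₃, sin 2πx₁, sin 2πx₂)`; both meet ALL THREE coordinate crosses, so only SKEW shear frames are
      admissible and their gravest mode lines are in the OSCILLATORY regime of the inhomogeneous Rayleigh problem — the
      one sub-case of THEOREM B (`stub_skewFrameResponse` of Cruxes/KolmogorovFloor/Lines/dressed-laminar-ray.md) nobody had
      checked. FIRST LEMMA of the card: `SkewRayF123` / `SkewRayFGP` — the skew frame `ξ = (0,1,1)`, `e = (1,1,−1)`
      (resp. `ξ = (1,1,0)`, `e = (1,−1,1)`) is an Euler shear orthogonal to the force carrying an approximate linear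
      response (numerics of this seat: toy/skew_ray.py, results in the card). Consequences (logic PROVED):
      `not_pairFor_f123`, `not_pairFor_fGP` (given THEOREM A), and `pair_witness_not_poly` (given THEOREM A and the
      ∀-polynomial response lemma): any witness of the crux is a NON-polynomial smooth force.
-/

noncomputable section

set_option linter.dupNamespace false

open MeasureTheory UnitAddTorus
open scoped InnerProductSpace ENNReal BigOperators

namespace Summit.AnomalousDissipation.AnomalousDissipation.Cruxes.KolmogorovFloorEnsembleCeiling.Ideator3

open Literature.Analysis.FunctionSpaces Literature.Analysis.FluidPDE
open Summit.AnomalousDissipation.AnomalousDissipation.Theses.TaylorCertificates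

local notation "𝕋³" => UnitAddTorus (Fin 3)
local notation "E³" => EuclideanSpace ℝ (Fin 3)
local notation "HH" => Literature.Analysis.FunctionSpaces.Torus.energySpace (Fin 3)

/-! ## §A  The coupling per force and its floor projection -/

/-- The Kolmogorov-class FLOOR DATUM at one viscosity (verbatim conjunct (i) of the crux). -/
def FloorDatum (f : 𝕋³ → E³) (ε₀ C Θ ν : ℝ) : Prop :=
  ∃ (N : ℕ) (Φ₁ : Literature.Analysis.FluidPDE.Torus.CylindricalTest (Fin 3)) (θ₁ : ℝ), (N : ℝ) ≤ C * ν ^ (-(3 / 4 : ℝ)) ∧ (∀ i, Literature.Analysis.FunctionSpaces.Torus.fourierTruncate N (Φ₁.g i) = Φ₁.g i) ∧ -Θ ≤ θ₁ ∧ θ₁ ≤ 0 ∧ ∀ u : Literature.Analysis.FunctionSpaces.Torus.energySpace (Fin 3), let uf : UnitAddTorus (Fin 3) → EuclideanSpace ℝ (Fin 3) := ((u : MeasureTheory.Lp (EuclideanSpace ℝ (Fin 3)) 2 (MeasureTheory.volume : MeasureTheory.Measure (UnitAddTorus (Fin 3)))) : UnitAddTorus (Fin 3) → EuclideanSpace ℝ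 (Fin 3)); let D : ℝ := ν * (Literature.Analysis.FunctionSpaces.Torus.eGradNormSq uf).toReal; let P : ℝ := Literature.Analysis.FluidPDE.Torus.pairing (u : MeasureTheory.Lp (EuclideanSpace ℝ (Fin 3)) 2 (MeasureTheory.volume : MeasureTheory.Measure (UnitAddTorus (Fin 3)))) f - D; Literature.Analysis.FunctionSpaces.Torus.eGradNormSq uf ≠ ⊤ → ‖u‖ ^ 2 ≤ 16 * (∫ x, ‖f x‖ ^ 2) / ν ^ 2 → ε₀ ≤ D + Literature.Analysis.FluidPDE.Torus.nsGeneratorPairing ν f u (Φ₁.grad u) + 2 * θ₁ * P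

/-- The ENSEMBLE CEILING at one viscosity (verbatim conjunct (ii) of the crux). -/
def CeilingAt (f : 𝕋³ → E³) (E ν : ℝ) : Prop :=
  ∀ μ : MeasureTheory.Measure (Literature.Analysis.FunctionSpaces.Torus.energySpace (Fin 3)), Literature.Analysis.FluidPDE.Torus.IsStationaryStatisticalSolution ν f μ → MeasureTheory.Integrable (fun v : Literature.Analysis.FunctionSpaces.Torus.energySpace (Fin 3) => ‖v‖ ^ 2) μ → Literature.Analysis.FluidPDE.Torus.ensembleEnergy μ ≤ E

/-- The SAME-FORCE COUPLING for ONE force `f`: the body of the crux after `∃ f, admissible ∧`. -/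
def PairFor (f : 𝕋³ → E³) : Prop :=
  ∃ (ε₀ C Θ E ν₀ : ℝ), 0 < ε₀ ∧ 0 < ν₀ ∧ ∀ ν : ℝ, 0 < ν → ν < ν₀ → FloorDatum f ε₀ C Θ ν ∧ CeilingAt f E ν

/-- The crux IS `∃ f admissible, PairFor f`, definitionally. -/
theorem pair_iff : KolmogorovFloorEnsembleCeiling ↔
    ∃ f : 𝕋³ → E³, Torus.IsSmooth f ∧ Torus.IsDivFree f ∧ Torus.HasZeroMean f ∧ PairFor f := Iff.rfl

/-- The band-limited floor class of exponent `β` for ONE force (verbatim `Cruxes/KolmogorovFloor/SketchIdeator3.lean`). -/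
def FloorClassAtFor (β : ℝ) (f : 𝕋³ → E³) : Prop :=
  ∃ (ε₀ C Θ ν₀ : ℝ), 0 < ε₀ ∧ 0 < ν₀ ∧ ∀ ν : ℝ, 0 < ν → ν < ν₀ →
    ∃ (N : ℕ) (Φ₁ : Torus.CylindricalTest (Fin 3)) (θ₁ : ℝ), (N : ℝ) ≤ C * ν ^ (-β) ∧
    (∀ i, Torus.fourierTruncate N (Φ₁.g i) = Φ₁.g i) ∧ -Θ ≤ θ₁ ∧ θ₁ ≤ 0 ∧
    ∀ u : HH,
      let uf : 𝕋³ → E³ := ((u : Lp (EuclideanSpace ℝ (Fin 3)) 2 (volume : Measure (UnitAddTorus (Fin 3)))) : 𝕋³ → E³)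
      let D : ℝ := ν * (Torus.eGradNormSq uf).toReal
      let P : ℝ := Torus.pairing (u : Lp (EuclideanSpace ℝ (Fin 3)) 2 (volume : Measure (UnitAddTorus (Fin 3)))) f - D
      Torus.eGradNormSq uf ≠ ⊤ → ‖u‖ ^ 2 ≤ 16 * (∫ x, ‖f x‖ ^ 2) / ν ^ 2 →
        ε₀ ≤ D + Torus.nsGeneratorPairing ν f u (Φ₁.grad u) + 2 * θ₁ * P

/-- FLOOR PROJECTION of the coupling, force kept (pure logic, PROVED): forget the ceiling and `E`. -/
theorem floorClass_of_pairFor {f : 𝕋³ → E³} (h : PairFor f) : FloorClassAtFor (3 / 4) f := by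
  obtain ⟨ε₀, C, Θ, E, ν₀, hε₀, hν₀, hall⟩ := h
  refine ⟨ε₀, C, Θ, ν₀, hε₀, hν₀, fun ν hν hνν₀ => ?_⟩
  obtain ⟨⟨N, Φ₁, θ₁, hN, hband, hθ, hθ', hu⟩, -⟩ := hall ν hν hνν₀
  exact ⟨N, Φ₁, θ₁, hN, hband, hθ, hθ', hu⟩

/-- CEILING PROJECTION of the coupling, force kept (pure logic, PROVED). -/
theorem ceiling_of_pairFor {f : 𝕋³ → E³} (h : PairFor f) :
    ∃ (E ν₀ : ℝ), 0 < ν₀ ∧ ∀ ν : ℝ, 0 < ν → ν < ν₀ → CeilingAt f E ν := by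
  obtain ⟨ε₀, C, Θ, E, ν₀, hε₀, hν₀, hall⟩ := h
  exact ⟨E, ν₀, hν₀, fun ν hν hνν₀ => (hall ν hν hνν₀).2⟩

/-- The `∀∃` KILL SHAPE of the band-limited class for one force (verbatim SketchIdeator3). -/
def FloorKillAtFor (β : ℝ) (f : 𝕋³ → E³) : Prop :=
  ∀ (ε₀ C Θ ν₀ : ℝ), 0 < ε₀ → 0 < ν₀ → ∃ ν : ℝ, 0 < ν ∧ ν < ν₀ ∧
    ∀ (N : ℕ) (Φ₁ : Torus.CylindricalTest (Fin 3)) (θ₁ : ℝ), (N : ℝ) ≤ C * ν ^ (-β) →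
    (∀ i, Torus.fourierTruncate N (Φ₁.g i) = Φ₁.g i) → -Θ ≤ θ₁ → θ₁ ≤ 0 →
    ∃ u : HH,
      Torus.eGradNormSq (((u : Lp (EuclideanSpace ℝ (Fin 3)) 2 (volume : Measure (UnitAddTorus (Fin 3)))) : 𝕋³ → E³)) ≠ ⊤ ∧
      ‖u‖ ^ 2 ≤ 16 * (∫ x, ‖f x‖ ^ 2) / ν ^ 2 ∧
      ν * (Torus.eGradNormSq (((u : Lp (EuclideanSpace ℝ (Fin 3)) 2 (volume : Measure (UnitAddTorus (Fin 3)))) : 𝕋³ → E³))).toReal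
        + Torus.nsGeneratorPairing ν f u (Φ₁.grad u)
        + 2 * θ₁ * (Torus.pairing (u : Lp (EuclideanSpace ℝ (Fin 3)) 2 (volume : Measure (UnitAddTorus (Fin 3)))) f
            - ν * (Torus.eGradNormSq (((u : Lp (EuclideanSpace ℝ (Fin 3)) 2 (volume : Measure (UnitAddTorus (Fin 3)))) : 𝕋³ → E³))).toReal) < ε₀

theorem not_floorClassAtFor_of_kill {β : ℝ} {f : 𝕋³ → E³} (hK : FloorKillAtFor β f) :
    ¬ FloorClassAtFor β f := by
  rintro ⟨ε₀, C, Θ, ν₀, hε₀, hν₀, h⟩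
  obtain ⟨ν, hν, hνν₀, hkill⟩ := hK ε₀ C Θ ν₀ hε₀ hν₀
  obtain ⟨N, Φ₁, θ₁, hN, hΦ₁, hθ₁, hθ₁', hu⟩ := h ν hν hνν₀
  obtain ⟨u, hfin, hball, hlt⟩ := hkill N Φ₁ θ₁ hN hΦ₁ hθ₁ hθ₁'
  exact absurd (hu u hfin hball) (not_le.mpr hlt)

/-- **A Kolmogorov-class floor kill for `f` refutes the coupling for `f`, whatever its ceiling half does** (PROVED). -/
theorem not_pairFor_of_kill {f : 𝕋³ → E³} (hK : FloorKillAtFor (3 / 4) f) : ¬ PairFor f :=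
  fun h => not_floorClassAtFor_of_kill hK (floorClass_of_pairFor h)

/-! ## §B  The dressed-ray interface (verbatim re-typing of Cruxes/KolmogorovFloor/SketchIdeator3.lean §B–§C) -/

/-- A smooth STEADY EULER SHEAR skeleton (`U = sin(2π ξ·x) ê`, `ξ ⊥ e` lattice vectors). -/
structure IsEulerShear (U : 𝕋³ → E³) : Prop where
  smooth : Torus.IsSmooth U
  divFree : Torus.IsDivFree U
  zeroMean : Torus.HasZeroMean U
  trigPoly : ∃ d : ℕ, Torus.fourierTruncate d U = U
  selfAdvection : ∀ x, Torus.convect U U x = 0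

/-- Weighted `ℓ¹` slope `Σ_{|k| ≤ D} |k| ‖ŵ(k)‖`. -/
def slopeSum (D : ℕ) (w : 𝕋³ → E³) : ℝ :=
  ∑ k ∈ Torus.freqBall D, Real.sqrt (Torus.freqNormSq k) * ‖mFourierCoeff (EuclideanSpace.complexify ∘ w) k‖

/-- `|k| ‖Ŵ(k)‖ ≤ M` for every frequency (the beat's prey). -/
def SlopeLE (W : 𝕋³ → E³) (M : ℝ) : Prop :=
  ∀ k : Fin 3 → ℤ, Real.sqrt (Torus.freqNormSq k) * ‖mFourierCoeff (EuclideanSpace.complexify ∘ W) k‖ ≤ M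

/-- APPROXIMATE LINEAR RESPONSE of the shear `U` to the force `f` — bounds (R1)–(R5). -/
def ApproxLinearResponse (f U : 𝕋³ → E³) : Prop :=
  ∃ Cb : ℝ, ∀ K : ℕ, 1 ≤ K → ∃ b : 𝕋³ → E³,
    Torus.IsSmooth b ∧ Torus.IsDivFree b ∧ Torus.HasZeroMean b ∧ Torus.fourierTruncate K b = b ∧
    (∫ x, ‖b x‖ ^ 2) ≤ Cb ∧ slopeSum K b ≤ Cb * K ∧ Torus.gradNormSq b ≤ Cb * K ∧
    ∀ (D : ℕ) (W : 𝕋³ → E³) (M : ℝ), Torus.IsSmooth W → Torus.IsDivFree W → Torus.HasZeroMean W →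
      Torus.fourierTruncate D W = W → SlopeLE W M →
      |∫ x, ⟪Torus.convect U b x + Torus.convect b U x - f x, W x⟫_ℝ| ≤ Cb / K * M ∧
      |∫ x, ⟪Torus.convect b b x, W x⟫_ℝ| ≤ Cb * (1 + Real.log K) * M

/-- THEOREM A of the KolmogorovFloor chain (DRESSED-RAY-r1-3 §2; `stub_endgame ∘ stub_rayOfResponse`). -/
def DressedRayKill : Prop :=
  ∀ f U : 𝕋³ → E³, Torus.IsSmooth f → Torus.IsDivFree f → Torus.HasZeroMean f →
    (∃ d : ℕ, Torus.fourierTruncate d f = f) → IsEulerShear U → (∫ x, ⟪U x, f x⟫_ℝ) = 0 →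
    ApproxLinearResponse f U → ∀ β : ℝ, β ≤ 3 / 4 → FloorKillAtFor β f

/-- THEOREM B, ∀-polynomial form (axis frames: `stub_axisFrameResponse`; skew frames: `stub_skewFrameResponse`). -/
def LinearResponseLemma : Prop :=
  ∀ f : 𝕋³ → E³, Torus.IsSmooth f → Torus.IsDivFree f → Torus.HasZeroMean f →
    (∃ d : ℕ, Torus.fourierTruncate d f = f) →
    ∃ U : 𝕋³ → E³, IsEulerShear U ∧ (∫ x, ⟪U x, f x⟫_ℝ) = 0 ∧ ApproxLinearResponse f U

/-! ## §C  The intersection candidates and the FIRST LEMMA of the card -/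

/-- `f₁₂₃(x) = (sin 2πx₃, sin 4πx₁, sin 6πx₂)` — the detuned cyclic force (re-typed from
Cruxes/EnsembleCeiling/SketchIdeator1.lean `detunedCyclicForce`). -/
def f123 : 𝕋³ → E³ := fun x =>
  (Literature.Analysis.FluidPDE.Torus.stokesMode (Pi.single (2 : Fin 3) (1 : ℤ))
      (EuclideanSpace.single (0 : Fin 3) (1 : ℝ)) false x
    + Literature.Analysis.FluidPDE.Torus.stokesMode (Pi.single (0 : Fin 3) (2 : ℤ))
      (EuclideanSpace.single (1 : Fin 3) (1 : ℝ)) false x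
    + Literature.Analysis.FluidPDE.Torus.stokesMode (Pi.single (1 : Fin 3) (3 : ℤ))
      (EuclideanSpace.single (2 : Fin 3) (1 : ℝ)) false x : E³)

/-- `f_GP(x) = (sin 2πx₃, sin 2πx₁, sin 2πx₂)` — the cyclic first-shell (Galloway–Proctor-type) force. -/
def fGP : 𝕋³ → E³ := fun x =>
  (Literature.Analysis.FluidPDE.Torus.stokesMode (Pi.single (2 : Fin 3) (1 : ℤ))
      (EuclideanSpace.single (0 : Fin 3) (1 : ℝ)) false x
    + Literature.Analysis.FluidPDE.Torus.stokesMode (Pi.single (0 : Fin 3) (1 : ℤ))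
      (EuclideanSpace.single (1 : Fin 3) (1 : ℝ)) false x
    + Literature.Analysis.FluidPDE.Torus.stokesMode (Pi.single (1 : Fin 3) (1 : ℤ))
      (EuclideanSpace.single (2 : Fin 3) (1 : ℝ)) false x : E³)

/-- The lattice frequency `(0,1,1)` and the streamwise direction `(1,1,-1)/√3` of skew frame A. -/
def xiA : Fin 3 → ℤ := ![0, 1, 1]
def eA : E³ := (Real.sqrt 3)⁻¹ • (EuclideanSpace.single (0 : Fin 3) (1 : ℝ) + EuclideanSpace.single (1 : Fin 3) (1 : ℝ)
  - EuclideanSpace.single (2 : Fin 3) (1 : ℝ))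
/-- Skew frame A: the unit Kolmogorov shear `U_A = sin(2π(x₂+x₃)) · (1,1,−1)/√3` (`ξ·e = 0`: an exact steady Euler flow). -/
def shearA : 𝕋³ → E³ := fun x => Literature.Analysis.FluidPDE.Torus.stokesMode xiA eA false x

/-- The frequency `(1,1,0)` and direction `(1,-1,1)/√3` of the skew frame of `f_GP` (triage-r1-3 Y2 of the #2 chain). -/
def xiG : Fin 3 → ℤ := ![1, 1, 0]
def eG : E³ := (Real.sqrt 3)⁻¹ • (EuclideanSpace.single (0 : Fin 3) (1 : ℝ) - EuclideanSpace.single (1 : Fin 3) (1 : ℝ)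
  + EuclideanSpace.single (2 : Fin 3) (1 : ℝ))
def shearG : 𝕋³ → E³ := fun x => Literature.Analysis.FluidPDE.Torus.stokesMode xiG eG false x

/-- **FIRST LEMMA of the card (skew / oscillatory-regime response for the intersection candidate `f₁₂₃`).**
The skew frame A is an Euler shear, orthogonal to `f₁₂₃`, and carries an approximate linear response (R1)–(R5).
Numerics (this seat, toy/skew_ray.py, J = 8192): `‖b‖² → 0.7265`, `K_{b_K} ≈ 1.05 K`, `‖∇b_K‖² ≈ 13.5 K`,
defect `≈ 8.9/K²` (a full power better than (R4)), self-advection `≈ 5 + 1.4 log K` (R5), log layer on all six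
mode lines including the oscillatory pair through `(0,0,±1)`. -/
def SkewRayF123 : Prop :=
  IsEulerShear shearA ∧ (∫ x, ⟪shearA x, f123 x⟫_ℝ) = 0 ∧ ApproxLinearResponse f123 shearA

/-- Same for `f_GP` in its skew frame (all six mode lines oscillatory): `‖b‖² → 1.94`, `K_{b_K} ≈ 1.5 K`,
`‖∇b_K‖² ≈ 28 K`, defect `≈ 7.8/K²`, self-advection `≈ 17 + 1.5 log K`. -/
def SkewRayFGP : Prop :=
  IsEulerShear shearG ∧ (∫ x, ⟪shearG x, fGP x⟫_ℝ) = 0 ∧ ApproxLinearResponse fGP shearG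

/-- Admissibility + polynomiality of a force, bundled (for `f₁₂₃`, `f_GP`: routine facts about `stokesMode`). -/
def AdmissiblePoly (f : 𝕋³ → E³) : Prop :=
  Torus.IsSmooth f ∧ Torus.IsDivFree f ∧ Torus.HasZeroMean f ∧ ∃ d : ℕ, Torus.fourierTruncate d f = f

/-- **The coupling fails at `f₁₂₃`** given THEOREM A and the first lemma (logic PROVED). -/
theorem not_pairFor_f123 (hK : DressedRayKill) (hf : AdmissiblePoly f123) (hR : SkewRayF123) : ¬ PairFor f123 :=
  not_pairFor_of_kill (hK f123 shearA hf.1 hf.2.1 hf.2.2.1 hf.2.2.2 hR.1 hR.2.1 hR.2.2 (3 / 4) le_rfl)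

/-- **The coupling fails at `f_GP`** likewise (logic PROVED). -/
theorem not_pairFor_fGP (hK : DressedRayKill) (hf : AdmissiblePoly fGP) (hR : SkewRayFGP) : ¬ PairFor fGP :=
  not_pairFor_of_kill (hK fGP shearG hf.1 hf.2.1 hf.2.2.1 hf.2.2.2 hR.1 hR.2.1 hR.2.2 (3 / 4) le_rfl)

/-- **Any witness of the crux is a NON-polynomial smooth force** given THEOREM A and the ∀-polynomial response lemma
(logic PROVED): the intersection question of the crux lives entirely in the full-Fourier-support class (THEOREM C territory). -/
theorem pair_witness_not_poly (hK : DressedRayKill) (hL : LinearResponseLemma) (h : KolmogorovFloorEnsembleCeiling) :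
    ∃ f : 𝕋³ → E³, Torus.IsSmooth f ∧ Torus.IsDivFree f ∧ Torus.HasZeroMean f ∧ PairFor f ∧
      ¬ ∃ d : ℕ, Torus.fourierTruncate d f = f := by
  obtain ⟨f, hfs, hfd, hfz, hpair⟩ := pair_iff.1 h
  refine ⟨f, hfs, hfd, hfz, hpair, fun hpoly => ?_⟩
  obtain ⟨U, hU, hUf, hLR⟩ := hL f hfs hfd hfz hpoly
  exact not_pairFor_of_kill (hK f U hfs hfd hfz hpoly hU hUf hLR (3 / 4) le_rfl) hpair

/-- Contrapositive packaging: THEOREM A + the ∀-polynomial response lemma + "no non-polynomial witness" refute the crux BY NAME. -/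
theorem not_pair_of_ray (hK : DressedRayKill) (hL : LinearResponseLemma)
    (hC : ∀ f : 𝕋³ → E³, Torus.IsSmooth f → Torus.IsDivFree f → Torus.HasZeroMean f →
      (¬ ∃ d : ℕ, Torus.fourierTruncate d f = f) → FloorKillAtFor (3 / 4) f) :
    ¬ KolmogorovFloorEnsembleCeiling := by
  intro h
  obtain ⟨f, hfs, hfd, hfz, hpair, hnp⟩ := pair_witness_not_poly hK hL h
  exact not_pairFor_of_kill (hC f hfs hfd hfz hnp) hpair

end Summit.AnomalousDissipation.AnomalousDissipation.Cruxes.KolmogorovFloorEnsembleCeiling.Ideator3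

end
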